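import Mathlib

/-!
# BridgePairwise — pairwise eigenvalue separation by one endomorphism (T4A-route-3.md Lemma 3.1)
(Tier 4, T4-A)

Seat p4 of the blind cell pub-hodge-repro2 (README §6, T4-A). route/T4A-route-3.md Lemma 3.1 and
route/TIER4.md Lemma A2.1 both choose one element `a = b + t` (`b` a primitive element of `𝐅`,
`t ∈ ℕ`) so that finitely many prescribed monomials `χ_m(a) = ∏_τ τ(a)^{m_τ}` in its conjugates are
PAIRWISE DISTINCT. With `r_τ := τ(b)` (pairwise distinct) this reads
`∏_τ (t + r_τ)^{m_τ} ≠ ∏_τ (t + r_τ)^{m′_τ}` for `m ≠ m′`. `BridgeEigenvalue` proved the special case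
`m′ = d·e_σ`; this file proves the general pairwise statement (`exists_pairwise_separation`):

* `pairPoly_ne_zero`: for `m ≠ m′` the polynomial `∏_τ (X + r_τ)^{m_τ} − ∏_τ (X + r_τ)^{m′_τ}` is
  non-zero — after cancelling the common factor `∏_τ (X + r_τ)^{min(m_τ, m′_τ)}` (ℂ[X] is a domain)
  the two reduced products have disjoint supports, and at `X = −r_τ` for a `τ` in the support of one
  of them that product vanishes while the other does not (its factors are `(r_σ − r_τ)^{…}`, `σ ≠ τ`);
  no unique-factorisation argument is needed;
* `exists_pairwise_separation`: the product of the finitely many non-zero difference polynomials is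
  non-zero, hence has a non-root among the natural numbers.
-/

namespace Summit.Ventures.HodgeRepro2.BridgePairwise

open Polynomial

variable {ι : Type*} [Fintype ι]

/-- The monomial polynomial `∏_τ (X + r_τ)^{m_τ} ∈ ℂ[X]`. -/
noncomputable def monoPoly (r : ι → ℂ) (m : ι → ℕ) : ℂ[X] := ∏ i, (X + C (r i)) ^ m i

/-- Evaluation of the monomial polynomial. -/
theorem eval_monoPoly (r : ι → ℂ) (m : ι → ℕ) (t : ℂ) :
    eval t (monoPoly r m) = ∏ i, (t + r i) ^ m i := by
  simp [monoPoly, eval_prod]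

/-- `monoPoly r (m + m′) = monoPoly r m * monoPoly r m′`. -/
theorem monoPoly_add (r : ι → ℂ) (m m' : ι → ℕ) :
    monoPoly r (m + m') = monoPoly r m * monoPoly r m' := by
  simp only [monoPoly, Pi.add_apply, pow_add, Finset.prod_mul_distrib]

/-- A monomial polynomial is non-zero (ℂ[X] is a domain and `X + C r ≠ 0`). -/
theorem monoPoly_ne_zero (r : ι → ℂ) (m : ι → ℕ) : monoPoly r m ≠ 0 := by
  unfold monoPoly
  apply Finset.prod_ne_zero_iff.2
  intro i _
  exact pow_ne_zero _ (X_add_C_ne_zero (r i))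

/-- A monomial polynomial vanishes at `−r_τ` when `m_τ ≥ 1`. -/
theorem eval_monoPoly_neg_eq_zero (r : ι → ℂ) (m : ι → ℕ) {τ : ι} (hτ : 1 ≤ m τ) :
    eval (-r τ) (monoPoly r m) = 0 := by
  rw [eval_monoPoly]
  apply Finset.prod_eq_zero (Finset.mem_univ τ)
  rw [neg_add_cancel, zero_pow]
  omega

/-- A monomial polynomial does not vanish at `−r_τ` when `m_τ = 0` and the `r_σ` are distinct. -/
theorem eval_monoPoly_neg_ne_zero (r : ι → ℂ) (hr : Function.Injective r) (m : ι → ℕ) {τ : ι}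
    (hτ : m τ = 0) : eval (-r τ) (monoPoly r m) ≠ 0 := by
  rw [eval_monoPoly]
  apply Finset.prod_ne_zero_iff.2
  intro σ _
  by_cases hστ : σ = τ
  · subst hστ
    rw [hτ, pow_zero]
    exact one_ne_zero
  · apply pow_ne_zero
    intro h
    apply hστ
    apply hr
    linear_combination h

/-- Two monomial polynomials with DISJOINT supports and distinct exponent vectors differ. -/
theorem monoPoly_ne_of_disjoint (r : ι → ℂ) (hr : Function.Injective r) {m₁ m₂ : ι → ℕ}
    (hdisj : ∀ τ, m₁ τ = 0 ∨ m₂ τ = 0) (hne : m₁ ≠ m₂) : monoPoly r m₁ ≠ monoPoly r m₂ := by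
  -- some coordinate differs; by disjointness one side is ≥ 1 and the other is 0 there
  have hex : ∃ τ, m₁ τ ≠ m₂ τ := by
    by_contra h
    apply hne
    funext τ
    by_contra h'
    exact h ⟨τ, h'⟩
  obtain ⟨τ, hτ⟩ := hex
  intro heq
  have h := congrArg (eval (-r τ)) heq
  rcases hdisj τ with h1 | h2
  · have h2 : 1 ≤ m₂ τ := by omega
    rw [eval_monoPoly_neg_eq_zero r m₂ h2] at h
    exact eval_monoPoly_neg_ne_zero r hr m₁ h1 h
  · have h1 : 1 ≤ m₁ τ := by omega
    rw [eval_monoPoly_neg_eq_zero r m₁ h1] at h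
    exact eval_monoPoly_neg_ne_zero r hr m₂ h2 h.symm

/-- **Two distinct monomial polynomials differ** (general exponent vectors): cancel the common
factor `monoPoly r (min m m′)` and apply the disjoint-support case. -/
theorem monoPoly_injective (r : ι → ℂ) (hr : Function.Injective r) :
    Function.Injective (monoPoly r) := by
  intro m m' heq
  by_contra hne
  -- reduced exponents
  let c : ι → ℕ := fun τ => min (m τ) (m' τ)
  let m₁ : ι → ℕ := fun τ => m τ - c τ
  let m₂ : ι → ℕ := fun τ => m' τ - c τ
  have hm : m = c + m₁ := by funext τ; simp only [Pi.add_apply, c, m₁]; omega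
  have hm' : m' = c + m₂ := by funext τ; simp only [Pi.add_apply, c, m₂]; omega
  have hdisj : ∀ τ, m₁ τ = 0 ∨ m₂ τ = 0 := by
    intro τ
    simp only [m₁, m₂, c]
    omega
  have hne' : m₁ ≠ m₂ := by
    intro h
    apply hne
    rw [hm, hm', h]
  apply monoPoly_ne_of_disjoint r hr hdisj hne'
  rw [hm, hm', monoPoly_add, monoPoly_add] at heq
  exact mul_left_cancel₀ (monoPoly_ne_zero r c) heq

/-- The difference polynomial of a pair of exponent vectors. -/
noncomputable def pairPoly (r : ι → ℂ) (m m' : ι → ℕ) : ℂ[X] := monoPoly r m - monoPoly r m'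

/-- For `m ≠ m′` the difference polynomial is non-zero. -/
theorem pairPoly_ne_zero (r : ι → ℂ) (hr : Function.Injective r) {m m' : ι → ℕ} (hne : m ≠ m') :
    pairPoly r m m' ≠ 0 := by
  unfold pairPoly
  rw [sub_ne_zero]
  exact fun h => hne (monoPoly_injective r hr h)

/-- **Pairwise eigenvalue separation** (T4A-route-3.md Lemma 3.1 / TIER4.md Lemma A2.1): for pairwise
distinct complex numbers `r_τ` and any finite set `M` of exponent vectors there is `t ∈ ℕ` with
`∏_τ (t + r_τ)^{m_τ} ≠ ∏_τ (t + r_τ)^{m′_τ}` for all `m ≠ m′` in `M`. With `r_τ = τ(b)` and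
`a = b + t`: the monomials `χ_m(a)`, `m ∈ M`, are pairwise distinct. -/
theorem exists_pairwise_separation (r : ι → ℂ) (hr : Function.Injective r) (M : Finset (ι → ℕ)) :
    ∃ t : ℕ, ∀ m ∈ M, ∀ m' ∈ M, m ≠ m' →
      (∏ i, ((t : ℂ) + r i) ^ m i) ≠ ∏ i, ((t : ℂ) + r i) ^ m' i := by
  classical
  set P : ℂ[X] := ∏ p ∈ (M ×ˢ M).filter (fun p => p.1 ≠ p.2), pairPoly r p.1 p.2 with hP
  have hP0 : P ≠ 0 := by
    rw [hP]
    apply Finset.prod_ne_zero_iff.2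
    intro p hp
    rw [Finset.mem_filter] at hp
    exact pairPoly_ne_zero r hr hp.2
  have hroot : ∃ t : ℕ, ¬ P.IsRoot (t : ℂ) := by
    by_contra hall
    have hall : ∀ t : ℕ, P.IsRoot (t : ℂ) := fun t => by
      by_contra hne
      exact hall ⟨t, hne⟩
    apply hP0
    apply Polynomial.eq_zero_of_infinite_isRoot
    apply Set.Infinite.mono (s := Set.range (fun t : ℕ => (t : ℂ)))
    · rintro x ⟨t, rfl⟩
      exact hall t
    · exact Set.infinite_range_of_injective Nat.cast_injective
  obtain ⟨t, ht⟩ := hroot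
  refine ⟨t, fun m hm m' hm' hne heq => ?_⟩
  apply ht
  rw [IsRoot, hP, eval_prod]
  refine Finset.prod_eq_zero (i := (m, m')) ?_ ?_
  · rw [Finset.mem_filter, Finset.mem_product]
    exact ⟨⟨hm, hm'⟩, hne⟩
  · simp only [pairPoly, eval_sub, eval_monoPoly]
    rw [heq, sub_self]

end Summit.Ventures.HodgeRepro2.BridgePairwise
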